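import Literature.AlgebraicGeometry.Resolution.LocalUniformizationClosedPoints
import Literature.AlgebraicGeometry.Resolution.CompositeValuations
import Literature.AlgebraicGeometry.Resolution.LocalUniformization
import Mathlib.FieldTheory.PurelyInseparable.Basic
import HarnessLib

/-!
# `PalterationThesis` (crux stmt-ResolutionOfSingularities-0552), line `Sketch` rev. c4:
# glue stub `stub_temkinAt_of_zeroDim` — Temkin's statement over `K` needs only
# zero-dimensional valuation rings

Glue stub `stub_temkinAt_of_zeroDim` of the skeleton `Sketch` (rev. c4) for crux
stmt-ResolutionOfSingularities-0552 (`--supports`, it does not close the item): Zariski's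
closed-point reduction for the atom "Temkin's inseparable local uniformization read at the
ground field `K`".

**Statement.** Fix a field `K`. Suppose that every valuation ring `O ∋ K` of a finitely
generated extension `F/K` that is ZERO-DIMENSIONAL over `K` (every `x ∈ O` is a root modulo
`𝔪_O` of a non-zero polynomial over `K`) acquires, on some finite purely inseparable extension
`L/F`, a valuation ring `O'` of `L` lying over it (`O'.comap (algebraMap F L) = O`) that is
locally uniformizable over `K` (`IsLocallyUniformizable K L O'`). Then the same holds for EVERY
valuation ring `O ∋ K` of `F`.

**Proof.** Refine `O` to a valuation ring `O₁ ∋ K` of `F` minimal among those containing the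
finitely generated `K`-subalgebra `⊥ = K` (`exists_minimal_valuationSubring_le`); it is
zero-dimensional over `K` (`exists_aeval_mem_nonunits_of_minimal`). The hypothesis provides
`L/F`, a valuation ring `O₁'` of `L` over `O₁` and a uniformizing algebra `A ⊆ O₁'`. The hull
`O' := comapHull O₁' (algebraMap F L) O` (`CompositeValuations.lean`) is a valuation ring of `L`
containing `O₁'` (`le_comapHull`) and lying over `O` (`comap_comapHull`, as
`O₁'.comap (algebraMap F L) = O₁ ≤ O`); it contains `A`, and `A` is regular at the centre of
`O'` because regularity at the centre descends to coarsenings (`isRegularLocalRing_centre_of_le`).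

Source: O. Zariski, P. Samuel, *Commutative Algebra* II (1960), Ch. VI §17 (closed points of the
Zariski–Riemann space); folklore.
-/

set_option linter.dupNamespace false -- mandated namespace of this single-conjunct summit

noncomputable section

open IsLocalRing Literature.AlgebraicGeometry.Resolution

namespace Summit.ResolutionOfSingularities.ResolutionOfSingularities.Theorems.PalterationThesis.PerfectAtoms

/-- **Temkin's statement over `K` needs only zero-dimensional valuation rings** (glue stub
`stub_temkinAt_of_zeroDim` of line `Sketch` rev. c4, crux stmt-0552; Zariski's closed-point
reduction with hulls). If every valuation ring `O ∋ K` of a finitely generated `F/K` whose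
residue field is algebraic over `K` acquires, on some finite purely inseparable `L/F`, a
valuation ring over it that is locally uniformizable over `K`, then so does EVERY valuation ring
`O ∋ K` of `F`: refine `O` to a minimal valuation ring `O₁ ∋ K`
(`exists_minimal_valuationSubring_le` with `R = ⊥`), zero-dimensional by
`exists_aeval_mem_nonunits_of_minimal`; take `L`, `O₁' ⊆ L` over `O₁` and its uniformizing
algebra `A`; the hull `O' := comapHull O₁' (algebraMap F L) O` (`le_comapHull`,
`comap_comapHull`, as `O₁ ≤ O`) lies over `O`, contains `O₁' ⊇ A`, and `A` is regular at its
centre by coarsening (`isRegularLocalRing_centre_of_le`). Any field `K`.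
[cite: ZariskiSamuel1960, Ch. VI §17] -/
theorem stub_temkinAt_of_zeroDim (K : Type) [Field K] :
    (∀ (F : Type) [Field F] [Algebra K F], (⊤ : IntermediateField K F).FG →
      ∀ O : ValuationSubring F, (∀ c : K, algebraMap K F c ∈ O) →
        (∀ x ∈ O, ∃ f : Polynomial K, f ≠ 0 ∧ Polynomial.aeval x f ∈ O.nonunits) →
        ∃ (L : Type) (_ : Field L) (_ : Algebra F L) (_ : Algebra K L) (_ : IsScalarTower K F L),
          FiniteDimensional F L ∧ IsPurelyInseparable F L ∧
          ∃ O' : ValuationSubring L, O'.comap (algebraMap F L) = O ∧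
            IsLocallyUniformizable K L O') →
    ∀ (F : Type) [Field F] [Algebra K F], (⊤ : IntermediateField K F).FG →
      ∀ O : ValuationSubring F, (∀ c : K, algebraMap K F c ∈ O) →
        ∃ (L : Type) (_ : Field L) (_ : Algebra F L) (_ : Algebra K L) (_ : IsScalarTower K F L),
          FiniteDimensional F L ∧ IsPurelyInseparable F L ∧
          ∃ O' : ValuationSubring L, O'.comap (algebraMap F L) = O ∧
            IsLocallyUniformizable K L O' := by
  intro h F _ _ hfg O hO
  -- the finitely generated `K`-subalgebra `⊥ = K` of `F` lies in `O`
  have hRO : (⊥ : Subalgebra K F).toSubring ≤ O.toSubring := fun x hx => by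
    obtain ⟨c, rfl⟩ := Algebra.mem_bot.mp (show x ∈ (⊥ : Subalgebra K F) from hx)
    exact hO c
  -- a closed point `O₁ ≤ O` of `Zar(F/K)`, zero-dimensional over `K`
  obtain ⟨O₁, hO₁O, hRO₁, hmin⟩ := exists_minimal_valuationSubring_le (⊥ : Subalgebra K F) O hRO
  have h0 : ∀ x ∈ O₁, ∃ f : Polynomial K, f ≠ 0 ∧ Polynomial.aeval x f ∈ O₁.nonunits :=
    exists_aeval_mem_nonunits_of_minimal (⊥ : Subalgebra K F) Subalgebra.fg_bot O₁ hRO₁ hmin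
  have hKO₁ : ∀ c : K, algebraMap K F c ∈ O₁ := fun c =>
    hRO₁ ((⊥ : Subalgebra K F).algebraMap_mem c)
  -- uniformize over `O₁` on a finite purely inseparable `L/F`
  obtain ⟨L, _, _, _, _, hfd, hpi, O₁', hO₁', A, hA, hAfg, hfr, hreg⟩ := h F hfg O₁ hKO₁ h0
  -- the hull of `O` over `O₁'` is a valuation ring of `L` over `O` containing `O₁' ⊇ A`
  have hle : O₁'.comap (algebraMap F L) ≤ O := by
    rw [hO₁']
    exact hO₁O
  have h₁ : O₁' ≤ comapHull O₁' (algebraMap F L) O := le_comapHull O₁' (algebraMap F L) O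
  have hA' : A.toSubring ≤ (comapHull O₁' (algebraMap F L) O).toSubring := fun x hx => h₁ (hA hx)
  exact ⟨L, inferInstance, inferInstance, inferInstance, inferInstance, hfd, hpi,
    comapHull O₁' (algebraMap F L) O, comap_comapHull O₁' (algebraMap F L) O hle,
    A, hA', hAfg, hfr, isRegularLocalRing_centre_of_le A h₁ hA hA' hreg⟩

end Summit.ResolutionOfSingularities.ResolutionOfSingularities.Theorems.PalterationThesis.PerfectAtoms

end
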